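import Summits.BirchSwinnertonDyer.BirchSwinnertonDyer.Theorems.GenusKolyvaginAtTwoGenusPrimitiveSupplyAtTwoPrimeHeegnerTwinDichotomyOfFacts
import Summits.BirchSwinnertonDyer.BirchSwinnertonDyer.Theorems.GenusKolyvaginAtTwoGenusPrimitiveSupplyAtTwoTwistSelmerTransferDownRat
import Summits.BirchSwinnertonDyer.BirchSwinnertonDyer.Theorems.GenusKolyvaginAtTwoGenusPrimitiveSupplyAtTwoDualityDischarged
import Summits.BirchSwinnertonDyer.BirchSwinnertonDyer.Theorems.GenusKolyvaginAtTwoCasselsTatePairingRat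
import Summits.BirchSwinnertonDyer.BirchSwinnertonDyer.Theorems.GenusKolyvaginAtTwoMinimalTwinBSDTwoSwappedPairPrimeFrame
import HarnessLib

/-!
# Route `GenusKolyvaginAtTwo`, crux U₂ `MinimalTwinBSDTwo` (stmt-BirchSwinnertonDyer-22985): THE `Δ < 0` CELL HAS A FREE DOOR —
# on the prime transposition frame the reversed supply's Selmer clause `#Sel₂(Wd) = 1` IS the local condition «`Sel₂(W)` not strict at `ℓ`»
# (a Čebotarev condition on `ℓ`), in contrast with the rigid `Δ > 0` cell (`…EggSplit`)

Seat `bsd-line-gk2-p3` g28 (PROVER seat 3/3, cell `bsd-f1-sign2`), `--supports stmt-BirchSwinnertonDyer-22985` (helper; closes nothing).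
THEOREMS ONLY (no definition, no named fact, no `sorry`); standard axioms.  **BSD is NOT proved by this file; U₂ is NOT proved; no item is
closed.**  §1 (DOWN) is UNCONDITIONAL — Mazur–Rubin Cor. 3.4 (i) at one transversal finite place, gk2's `GenusKolyTwistLocal.natCard_selmerGroup_
eq_two_mul_of_not_le_strictLocalKer` with Poitou–Tate and Tate's χ fed by the tree theorems `poitouTate_selmerStructure_duality_real_holds` /
`GenusKolyLowering.localEP`; §2 (UP and the iff) is CONDITIONAL on the two STATEMENT-ONLY print items the route already carries — `2`-parity
(`TwoParityDD`, Dokchitser–Dokchitser 2010 Thm. 1.4; binder `hpar`) and modularity (`exists_isNewformOf`; binder `hmod`) — the Cassels–Tate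
binder of gk2's `cor34i_twin_prime_heegner_of_facts'` being DISCHARGED by the landed `casselsTatePairingRat_proof`.

THE POINT (planner currency).  On the reversed PRIME frame of the `Δ < 0` cell `hTw1` (`W/ℚ` globally minimal, `Δ_W < 0`, `ρ̄_{W,2}` onto,
`#Sel₂(W) = 2`; `K = ℚ(√−ℓ)`, `d_K = −ℓ` odd, Heegner for `N_W`, `2` split; `Wd` any model of `W^(d_K)`) the ramified prime `ℓ` is of
transposition type (`PrimeFrame.ncard_roots_eq_one_of_discr_eq_neg_prime_of_Δ_neg`, p769168) and carries the ONLY place where the Kummer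
conditions of `W` and `Wd` differ; so `#Sel₂(Wd) ∈ {1, 4}` with
  **`#Sel₂(Wd) = 1` ⟺ `Sel₂(W) ⊄ strictLocalKer_ℓ`** (the generator `κ(P)` of `Sel₂(W)` is locally non-trivial at `ℓ`, i.e. `P ∉ 2W(ℚ_ℓ)`).
Unlike the `Δ > 0` cell (rigid: decided by the egg, `Egg.natCard_selmerGroup_twin_of_silent`), this is a condition ON `ℓ`, open for Čebotarev —
the U₂-side twin of the sibling seats' instrument «both Kummer bit values occur at transposition primes» (gk2-p5 g35,
`exists_isArithFrobAt_transposition_bit_ne_zero_of_habitat`).  Hence S2⁻′ (this seat's prime-frame reversed supply, p767140 / p768862) may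
replace its clause `#Sel₂(Wd) = 1` by the LOCAL clause `¬ Sel₂(W) ≤ strictLocalKer W ℚ_ℓ 2` (§1, unconditionally sufficient; §2, necessary
mod 2-parity + modularity).

* §1 **`natCard_selmerGroup_twin_eq_one_of_not_strict`** (DOWN, unconditional).
* §2 **`natCard_selmerGroup_twin_eq_four_of_strict_of_facts`** (UP, mod `hpar`, `hmod`) and
  **`natCard_selmerGroup_twin_eq_one_iff_not_strict_of_facts`** (the door, mod `hpar`, `hmod`).

References: [MazurRubin2010] Lemma 2.11, Prop. 3.3, Cor. 3.4 (i); [Kramer1981] Prop. 3, Thm. 1; [DokchitserDokchitserAnnals2010] Thm. 1.4;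
[MilneADT2006] I Thm. 4.10, 6.13; [Miller2011LMS] Def. 1.1.
-/

set_option autoImplicit false
set_option linter.dupNamespace false -- `Summit.<P>.<Sub>` repeats `BirchSwinnertonDyer` (D-0017)

noncomputable section

open scoped Classical AddSubgroup

open NumberField WeierstrassCurve Literature.NumberTheory.EllipticCurves Literature.NumberTheory.QuadraticFields
open IsDedekindDomain
open Literature.NumberTheory.GaloisCohomology Literature.NumberTheory.GaloisRepresentations
open Literature.NumberTheory.EllipticCurves.ModularForms (exists_isNewformOf)
open Summit.BirchSwinnertonDyer.BirchSwinnertonDyer.Theorems.SchneiderFreeAdditiveX3.PoitouTateReduction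
  (poitouTate_selmerStructure_duality_real_holds)
open Summit.BirchSwinnertonDyer.BirchSwinnertonDyer.Theorems (casselsTatePairingRat_proof)

namespace Summit.BirchSwinnertonDyer.BirchSwinnertonDyer.Theorems.GenusExact.TwinSwap.Door

variable (W : WeierstrassCurve ℚ) [W.IsElliptic] [W.IsGloballyMinimal] {K : Type} [Field K] [NumberField K]

/-! ## §1 DOWN — unconditional -/

/-- **DOWN on the prime transposition frame — UNCONDITIONAL.**  `W/ℚ` globally minimal elliptic with `Δ_W < 0` and `#Sel₂(W) = 2`; `K`
imaginary quadratic with `d_K = −ℓ` odd, Heegner for `N_W`, `2` split; `Wd` any elliptic model of `W^(d_K)`.  If `Sel₂(W)` is NOT contained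
in the strict local kernel at `ℓ` (its non-zero class is locally non-trivial at `ℓ`) then **`#Sel₂(Wd) = 1`**.  gk2's
`GenusKolyTwistLocal.natCard_selmerGroup_eq_two_mul_of_not_le_strictLocalKer` (Mazur–Rubin Cor. 3.4 (i), `T = {ℓ}`) with Poitou–Tate / Tate χ
fed by tree theorems.  [cite: MazurRubin2010, Lemma 2.11, Prop. 3.3, Cor. 3.4 (i)] [cite: MilneADT2006, I Thm. 4.10] -/
theorem natCard_selmerGroup_twin_eq_one_of_not_strict (hΔ : W.Δ < 0) (hSel : Nat.card (W.selmerGroup 2) = 2)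
    (hK : IsImaginaryQuadratic K) (hodd : Odd (discr K)) (hH : SatisfiesHeegnerHypothesis (W.conductorNorm ℤ) K)
    (h2K : ((Ideal.span {(2 : ℤ)}).primesOver (𝓞 K)).ncard = 2)
    {ℓ : ℕ} [Fact ℓ.Prime] (hd : discr K = -(ℓ : ℤ)) (Wd : WeierstrassCurve ℚ) [Wd.IsElliptic]
    (hWd : ∃ C : VariableChange ℚ, C • W.quadraticTwist (discr K : ℚ) = Wd)
    (hns : ¬ W.selmerGroup 2 ≤ MazurRubin2010.strictLocalKer W ℚ_[ℓ] 2) :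
    Nat.card (Wd.selmerGroup 2) = 1 := by
  have h := GenusKolyTwistLocal.natCard_selmerGroup_eq_two_mul_of_not_le_strictLocalKer W
    (poitouTate_selmerStructure_duality_real_holds (K := ℚ)) (GenusKolyLowering.localEP ℚ) hΔ hK hodd hH h2K hd Wd hWd hns
  omega

/-! ## §2 UP and the door — modulo 2-parity and modularity -/

/-- **UP on the prime transposition frame** (mod `2`-parity + modularity; Cassels–Tate discharged by `casselsTatePairingRat_proof`).  Same frame
with `ρ̄_{W,2}` onto: if `Sel₂(W) ≤ strictLocalKer_ℓ` (its class is locally trivial at `ℓ`) then **`#Sel₂(Wd) = 4`**.  gk2's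
`GenusKolyTwin.cor34i_twin_prime_heegner_of_facts'`, UP half.  [cite: MazurRubin2010, Cor. 3.4 (i)] [cite: DokchitserDokchitserAnnals2010, Thm. 1.4] -/
theorem natCard_selmerGroup_twin_eq_four_of_strict_of_facts
    (hpar : ∀ (V : WeierstrassCurve ℚ) [V.IsElliptic], p_parity V 2) (hmod : exists_isNewformOf)
    (hΔ : W.Δ < 0) (hsurj : W.HasSurjectiveModNGaloisRep 2) (hSel : Nat.card (W.selmerGroup 2) = 2)
    (hK : IsImaginaryQuadratic K) (hodd : Odd (discr K)) (hH : SatisfiesHeegnerHypothesis (W.conductorNorm ℤ) K)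
    (h2K : ((Ideal.span {(2 : ℤ)}).primesOver (𝓞 K)).ncard = 2)
    {ℓ : ℕ} [Fact ℓ.Prime] (hd : discr K = -(ℓ : ℤ)) (Wd : WeierstrassCurve ℚ) [Wd.IsElliptic]
    (hWd : ∃ C : VariableChange ℚ, C • W.quadraticTwist (discr K : ℚ) = Wd)
    (hs : W.selmerGroup 2 ≤ MazurRubin2010.strictLocalKer W ℚ_[ℓ] 2) :
    Nat.card (Wd.selmerGroup 2) = 4 := by
  have h := (GenusKolyTwin.cor34i_twin_prime_heegner_of_facts' W (poitouTate_selmerStructure_duality_real_holds (K := ℚ))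
    (GenusKolyLowering.localEP ℚ) hpar casselsTatePairingRat_proof hmod hΔ
    (GenusKolyTwistLocal.torsionBy_two_eq_bot_of_hasSurjectiveModNGaloisRep_rat W hsurj) hK hodd hH h2K hd Wd hWd).1 hs
  omega

/-- **THE DOOR: `#Sel₂(Wd) = 1` ⟺ `Sel₂(W)` is not strict at `ℓ`** on the prime transposition frame of the `Δ < 0` cell (`ρ̄_{W,2}` onto,
`#Sel₂(W) = 2`), mod `2`-parity + modularity.  The reversed supply's Selmer clause on `hTw1` is a LOCAL condition at the twisting prime —
free for Čebotarev, not rigid.  [cite: MazurRubin2010, Prop. 3.3, Cor. 3.4 (i)] [cite: DokchitserDokchitserAnnals2010, Thm. 1.4]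
[cite: Miller2011LMS, Def. 1.1] -/
theorem natCard_selmerGroup_twin_eq_one_iff_not_strict_of_facts
    (hpar : ∀ (V : WeierstrassCurve ℚ) [V.IsElliptic], p_parity V 2) (hmod : exists_isNewformOf)
    (hΔ : W.Δ < 0) (hsurj : W.HasSurjectiveModNGaloisRep 2) (hSel : Nat.card (W.selmerGroup 2) = 2)
    (hK : IsImaginaryQuadratic K) (hodd : Odd (discr K)) (hH : SatisfiesHeegnerHypothesis (W.conductorNorm ℤ) K)
    (h2K : ((Ideal.span {(2 : ℤ)}).primesOver (𝓞 K)).ncard = 2)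
    {ℓ : ℕ} [Fact ℓ.Prime] (hd : discr K = -(ℓ : ℤ)) (Wd : WeierstrassCurve ℚ) [Wd.IsElliptic]
    (hWd : ∃ C : VariableChange ℚ, C • W.quadraticTwist (discr K : ℚ) = Wd) :
    Nat.card (Wd.selmerGroup 2) = 1 ↔ ¬ W.selmerGroup 2 ≤ MazurRubin2010.strictLocalKer W ℚ_[ℓ] 2 := by
  constructor
  · intro h1 hs
    have h4 := natCard_selmerGroup_twin_eq_four_of_strict_of_facts W hpar hmod hΔ hsurj hSel hK hodd hH h2K hd Wd hWd hs
    omega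
  · exact natCard_selmerGroup_twin_eq_one_of_not_strict W hΔ hSel hK hodd hH h2K hd Wd hWd

end Summit.BirchSwinnertonDyer.BirchSwinnertonDyer.Theorems.GenusExact.TwinSwap.Door

end
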